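import Summits.AtomisticToContinuum.FouriersLaw.Theorems.HiddenChargeMazurOddChargeAlgebraToolkit
import Summits.AtomisticToContinuum.FouriersLaw.Theorems.HiddenChargeMazurOddChargeAlgebraToolkitC

/-!
# Odd conservation laws of the pinned anharmonic chain — the transport recursion, first steps

File `Core1` of the NEGATIVE edge of crux `HiddenChargeMazur.OddChargeExists`: the leading
p-linear member `Σ_y a_y p_y` of a putative momentum-odd conservation law of span `D` has forced
ends `a_0 = c · lead0 D`, `a_D = c · leadD D`, satisfies the transport equations
`(★)_y : Φ(q_0,q_1) S(∂_0 a_{y-1} + ∂_{y-1} a_0) = Φ(q_{D+1},q_D) (∂_D a_y + ∂_y a_D)`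
and vanishes on `q_D = 0`.  These force `a_1 = c · lead1 D` (`core_step_one`),
`a_2 = c · leadMid D 2` (`core_step_two`) and `a_{y-1} = c · leadMid D (y-1) ⇒ a_y =
c · leadMid D y` for `3 ≤ y ≤ D - 2` (`core_step_generic`): `(★)_y` determines `∂_D a_y` (cancel
`Φ(q_{D+1},q_D) ≠ 0` in the domain `𝓡`), the closed form has the same `∂_D` and also vanishes at
`q_D = 0`, and a polynomial is determined by these two data (characteristic zero). [folklore]
-/

noncomputable section

open MvPolynomial
open scoped BigOperators

namespace Summit.AtomisticToContinuum.FouriersLaw.Theorems.OddChargeAlgebra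

/-! ### §0 Private complements to the toolkit files -/

/-- `∂ (f²) = 2 f ∂ f`. [folklore] -/
private theorem pd_sq (v : Var) (f : R) : pderiv v (f ^ 2) = 2 * f * pderiv v f := by
  rw [sq, pderiv_mul]; ring

/-- `∂_{q_i} γ_j = -1` when `i = j + 1` (index supplied up to ring normalisation). [folklore] -/
private theorem pd_gam_succ' {i j : ℤ} (h : j + 1 = i) : pderiv (Sum.inl i) (gam j) = -1 := by
  subst h; exact pderiv_inl_gam_succ j

/-- `∂_{q_i} Π_{[a,b)} = 0` when `q_i` does not occur in it (`i < a` or `i > b`). [folklore] -/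
private theorem pd_prodsq_zero {i a b : ℤ} (h : i < a ∨ b < i) :
    pderiv (Sum.inl i) (prodsq (Finset.Ico a b)) = 0 :=
  pderiv_inl_prodsq_eq_zero (by simp only [Finset.mem_Ico]; omega)
    (by simp only [Finset.mem_Ico]; omega)

/-- Leibniz rule for the cubic `cub`. [folklore] -/
private theorem pd_cub (v : Var) (a b : R) : pderiv v (cub a b) =
    3 * (a - b) ^ 2 * (pderiv v a - pderiv v b) + 3 * b ^ 2 * pderiv v b := by
  rw [show cub a b = (a - b) * (a - b) * (a - b) + b * b * b by unfold cub; ring]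
  simp only [map_add, pderiv_mul, map_sub]; ring

/-- `∂_{q_i} Φ(q_j,q_k) = 0` for `i ∉ {j,k}`. [folklore] -/
private theorem pd_cubX_zero {i j k : ℤ} (h1 : i ≠ j) (h2 : i ≠ k) :
    pderiv (Sum.inl i) (cub (X (Sum.inl j)) (X (Sum.inl k))) = 0 := by
  rw [pd_cub, pderiv_inl_X_inl_of_ne h1, pderiv_inl_X_inl_of_ne h2]; ring

/-- `∂_{q_0} Φ(q_0,q_1) = 3 γ_0²`. [folklore] -/
private theorem pd0_PhiL :
    pderiv (Sum.inl 0) (cub (X (Sum.inl 0)) (X (Sum.inl 1))) = 3 * gam 0 ^ 2 := by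
  rw [pd_cub, pderiv_X_self, pderiv_inl_X_inl_of_ne (by norm_num)]
  simp only [gam, zero_add]; ring

/-- `∂_{q_1} Φ(q_0,q_1) = -3q_0² + 6q_0q_1`. [folklore] -/
private theorem pd1_PhiL : pderiv (Sum.inl 1) (cub (X (Sum.inl 0)) (X (Sum.inl 1))) =
    -(3 * X (Sum.inl 0) ^ 2) + 6 * X (Sum.inl 0) * X (Sum.inl 1) := by
  rw [pd_cub, pderiv_X_self, pderiv_inl_X_inl_of_ne (by norm_num)]
  ring

/-- `∂_{q_D} Φ(q_D,q_{D-1}) = 3 γ_{D-1}²`. [folklore] -/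
private theorem pdD_PhiR (D : ℤ) :
    pderiv (Sum.inl D) (cub (X (Sum.inl D)) (X (Sum.inl (D - 1)))) = 3 * gam (D - 1) ^ 2 := by
  rw [pd_cub, pderiv_X_self, pderiv_inl_X_inl_of_ne (by omega)]
  simp only [gam, sub_add_cancel]; ring

/-- `Π_{[a,c)} = Π_{[a,b)} Π_{[b,c)}` (explicit arguments; cf. `prodsq_Ico_split`). [folklore] -/
private theorem prodsq_split (a b c : ℤ) (hab : a ≤ b) (hbc : b ≤ c) :
    prodsq (Finset.Ico a c) = prodsq (Finset.Ico a b) * prodsq (Finset.Ico b c) :=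
  prodsq_Ico_split hab hbc

/-- `Π_{[a,a+1)} = γ_a²`. [folklore] -/
private theorem prodsq_single (a b : ℤ) (h : b = a + 1) :
    prodsq (Finset.Ico a b) = gam a ^ 2 := by
  subst h; rw [prodsq_Ico_succ le_rfl, prodsq_Ico_eq_one le_rfl, one_mul]

/-- `Π_{[a,a+2)} = γ_a² γ_{a+1}²`. [folklore] -/
private theorem prodsq_pair (a m b : ℤ) (hm : m = a + 1) (hb : b = a + 2) :
    prodsq (Finset.Ico a b) = gam a ^ 2 * gam m ^ 2 := by
  rw [prodsq_split a m b (by omega) (by omega), prodsq_single a m hm, prodsq_single m b (by omega)]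

/-- `Π_{[a,a)} = 1`. [folklore] -/
private theorem prodsq_empty' (a : ℤ) : prodsq (Finset.Ico a a) = 1 := prodsq_Ico_eq_one le_rfl

/-- `cub` vanishes when its first argument `q_D` is killed. [folklore] -/
private theorem killVar_cub_self (D : ℤ) (b : R) :
    killVar (Sum.inl D) (cub (X (Sum.inl D)) b) = 0 := by
  simp [killVar, cub]

/-- Absorbing the normalisation `⅓`: if `P = ⅓ · (3 Z)` then `P = Z`. [folklore] -/
private theorem third_trick {P Z : R} (h : P = C (1 / 3 : ℝ) * (3 * Z)) : P = Z := by
  have h3 : C (1 / 3 : ℝ) * (3 : R) = 1 := by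
    rw [← map_ofNat C 3, ← map_mul]
    norm_num
  rw [h, ← mul_assoc, h3, one_mul]

/-- Integration tool: a polynomial is determined by its `q_v`-derivative and its restriction to
`q_v = 0`. [folklore] -/
private theorem eq_of_pderiv_of_killVar {v : Var} {P Q : R} (h1 : pderiv v P = pderiv v Q)
    (h2 : killVar v P = killVar v Q) : P = Q :=
  sub_eq_zero.mp (eq_zero_of_pderiv_of_killVar (by rw [map_sub, h1, sub_self])
    (by rw [map_sub, h2, sub_self]))

/-! ### §1 Partial derivatives of the closed forms -/

/-- `∂_{q_0} lead0 D = Φ_R · 2γ_0 · Π_{[1,D-1)}` (`D ≥ 2`). [folklore] -/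
private theorem pd0_lead0 {D : ℤ} (hD : 2 ≤ D) : pderiv (Sum.inl 0) (lead0 D) =
    cub (X (Sum.inl D)) (X (Sum.inl (D - 1))) * (2 * gam 0 * prodsq (Finset.Ico 1 (D - 1))) := by
  unfold lead0
  rw [prodsq_split 0 1 (D - 1) (by norm_num) (by omega), prodsq_single 0 1 (by norm_num)]
  simp (disch := omega) only [pderiv_mul, pd_sq, pd_cubX_zero, pd_prodsq_zero, pderiv_inl_gam_self,
    mul_zero, zero_mul, zero_add, add_zero, mul_one]

/-- `∂_{q_k} lead0 D = Φ_R Π_{[0,k-1)} · 2γ_{k-1}γ_k(γ_{k-1} - γ_k) · Π_{[k+1,D-1)}` for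
`1 ≤ k ≤ D-2`. [folklore] -/
private theorem pdk_lead0 {D k : ℤ} (hk : 1 ≤ k) (hkD : k ≤ D - 2) :
    pderiv (Sum.inl k) (lead0 D) = cub (X (Sum.inl D)) (X (Sum.inl (D - 1)))
      * (prodsq (Finset.Ico 0 (k - 1)) * (2 * gam (k - 1) * gam k * (gam (k - 1) - gam k))
          * prodsq (Finset.Ico (k + 1) (D - 1))) := by
  unfold lead0
  rw [prodsq_split 0 (k - 1) (D - 1) (by omega) (by omega),
    prodsq_split (k - 1) (k + 1) (D - 1) (by omega) (by omega),
    prodsq_pair (k - 1) k (k + 1) (by ring) (by ring)]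
  simp (disch := omega) only [pderiv_mul, pd_sq, pd_cubX_zero, pd_prodsq_zero,
    pderiv_inl_gam_self, pd_gam_succ', mul_zero, zero_mul, zero_add, add_zero, mul_one]
  ring

/-- `∂_{q_1} leadD D = -(Φ_b γ_1² + 2Φ_L γ_1) Π_{[2,D)}` (`D ≥ 2`). [folklore] -/
private theorem pd1_leadD {D : ℤ} (hD : 2 ≤ D) : pderiv (Sum.inl 1) (leadD D) =
    -((-(3 * X (Sum.inl 0) ^ 2) + 6 * X (Sum.inl 0) * X (Sum.inl 1))
          * (gam 1 ^ 2 * prodsq (Finset.Ico 2 D))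
        + cub (X (Sum.inl 0)) (X (Sum.inl 1)) * (2 * gam 1 * prodsq (Finset.Ico 2 D))) := by
  unfold leadD
  rw [prodsq_split 1 2 D (by norm_num) (by omega), prodsq_single 1 2 (by norm_num)]
  simp (disch := omega) only [map_neg, pderiv_mul, pd_sq, pd1_PhiL, pd_prodsq_zero,
    pderiv_inl_gam_self, mul_zero, add_zero, mul_one]

/-- `∂_{q_k} leadD D = -Φ_L Π_{[1,k-1)} · 2γ_{k-1}γ_k(γ_{k-1} - γ_k) · Π_{[k+1,D)}` for
`2 ≤ k ≤ D-1`. [folklore] -/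
private theorem pdk_leadD {D k : ℤ} (hk : 2 ≤ k) (hkD : k ≤ D - 1) :
    pderiv (Sum.inl k) (leadD D) = -(cub (X (Sum.inl 0)) (X (Sum.inl 1))
      * (prodsq (Finset.Ico 1 (k - 1)) * (2 * gam (k - 1) * gam k * (gam (k - 1) - gam k))
          * prodsq (Finset.Ico (k + 1) D))) := by
  unfold leadD
  rw [prodsq_split 1 (k - 1) D (by omega) (by omega),
    prodsq_split (k - 1) (k + 1) D (by omega) (by omega),
    prodsq_pair (k - 1) k (k + 1) (by ring) (by ring)]
  simp (disch := omega) only [map_neg, pderiv_mul, pd_sq, pd_cubX_zero, pd_prodsq_zero,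
    pderiv_inl_gam_self, pd_gam_succ', mul_zero, zero_mul, zero_add, add_zero, mul_one]
  ring

/-- `∂_{q_D} lead1 D = γ_{D-1}² γ_1 (6Φ_L + Φ_b γ_1) Π_{[2,D-1)}``, `D ≥ 3`.
[folklore] -/
private theorem pdD_lead1 {D : ℤ} (hD : 3 ≤ D) :
    pderiv (Sum.inl D) (lead1 D) = gam (D - 1) ^ 2 * gam 1
      * (6 * cub (X (Sum.inl 0)) (X (Sum.inl 1))
          + (-(3 * X (Sum.inl 0) ^ 2) + 6 * X (Sum.inl 0) * X (Sum.inl 1)) * gam 1)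
      * prodsq (Finset.Ico 2 (D - 1)) := by
  refine third_trick ?_
  unfold lead1
  rw [pderiv_C_mul]
  congr 1
  simp (disch := omega) only [pderiv_mul, map_add, map_neg, pd_sq, pderiv_ofNat, pdD_PhiR,
    pd_cubX_zero, pderiv_inl_X_inl_of_ne, pderiv_inl_gam_of_ne, pd_prodsq_zero, mul_zero,
    zero_mul, add_zero, neg_zero]
  ring

/-- `∂_{q_0} lead1 D = 2 Φ_R γ_0 γ_1 (3γ_0 - γ_1) Π_{[2,D-1)}` (`D ≥ 3`). [folklore] -/
private theorem pd0_lead1 {D : ℤ} (hD : 3 ≤ D) :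
    pderiv (Sum.inl 0) (lead1 D) = 2 * cub (X (Sum.inl D)) (X (Sum.inl (D - 1))) * gam 0 * gam 1
      * (3 * gam 0 - gam 1) * prodsq (Finset.Ico 2 (D - 1)) := by
  refine third_trick ?_
  unfold lead1
  rw [pderiv_C_mul]
  congr 1
  simp (disch := omega) only [pderiv_mul, map_add, map_neg, pd_sq, pderiv_ofNat, pd0_PhiL,
    pd_cubX_zero, pderiv_inl_X_inl_of_ne, pderiv_X_self, pderiv_inl_gam_of_ne, pd_prodsq_zero,
    mul_zero, zero_mul, zero_add, add_zero, mul_one]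
  simp only [gam, zero_add, Int.reduceAdd]
  ring

/-- `∂_{q_0} leadMid D z = γ_0² Φ_R γ_{z-1}γ_z[(4z+2)γ_{z-1} - (4z-2)γ_z] Π_{[1,z-1)}`
`· Π_{[z+1,D-1)}` for `z ≥ 2`, `D ≥ 2`. [folklore] -/
private theorem pd0_leadMid {D z : ℤ} (hz : 2 ≤ z) (hD : 2 ≤ D) :
    pderiv (Sum.inl 0) (leadMid D z) =
      gam 0 ^ 2 * cub (X (Sum.inl D)) (X (Sum.inl (D - 1))) * gam (z - 1) * gam z
        * (C ((4 * z + 2 : ℤ) : ℝ) * gam (z - 1) - C ((4 * z - 2 : ℤ) : ℝ) * gam z)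
        * (prodsq (Finset.Ico 1 (z - 1)) * prodsq (Finset.Ico (z + 1) (D - 1))) := by
  refine third_trick ?_
  unfold leadMid
  rw [pderiv_C_mul]
  congr 1
  simp (disch := omega) only [pderiv_mul, map_sub, pderiv_C, pd0_PhiL, pd_cubX_zero,
    pderiv_inl_gam_of_ne, pd_prodsq_zero, mul_zero, zero_mul, add_zero, sub_self]
  ring

/-- `∂_{q_D} leadMid D y = Φ_L γ_{D-1}² γ_{y-1}γ_y[(4y+2)γ_{y-1} - (4y-2)γ_y] Π_{[1,y-1)}`
`· Π_{[y+1,D-1)}` for `1 ≤ y ≤ D-2`. [folklore] -/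
private theorem pdD_leadMid {D y : ℤ} (hy : 1 ≤ y) (hyD : y ≤ D - 2) :
    pderiv (Sum.inl D) (leadMid D y) =
      cub (X (Sum.inl 0)) (X (Sum.inl 1)) * gam (D - 1) ^ 2 * gam (y - 1) * gam y
        * (C ((4 * y + 2 : ℤ) : ℝ) * gam (y - 1) - C ((4 * y - 2 : ℤ) : ℝ) * gam y)
        * (prodsq (Finset.Ico 1 (y - 1)) * prodsq (Finset.Ico (y + 1) (D - 1))) := by
  refine third_trick ?_
  unfold leadMid
  rw [pderiv_C_mul]
  congr 1
  simp (disch := omega) only [pderiv_mul, map_sub, pderiv_C, pdD_PhiR, pd_cubX_zero,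
    pderiv_inl_gam_of_ne, pd_prodsq_zero, mul_zero, zero_mul, add_zero, sub_self]
  ring

/-! ### §2 The steps `y = 1`, `y = 2` and the generic step `3 ≤ y ≤ D - 2` -/

/-- **Step `y = 1` of the transport recursion** (`D ≥ 3`): if `a_0 = c·lead0 D`,
`a_D = c·leadD D`, the transport equation `(★)_1` holds and `a_1` vanishes on `q_D = 0`, then
`a_1 = c·lead1 D`. [folklore] -/
theorem core_step_one : ∀ {D : ℤ} (c : ℝ) (a : ℤ → R), 3 ≤ D →
    (∀ z, a z ∈ supported ℝ (Sum.inl '' Set.Icc (0 : ℤ) D)) → a 0 = C c * lead0 D →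
    a D = C c * leadD D →
    cub (X (Sum.inl 0)) (X (Sum.inl 1))
        * shift (pderiv (Sum.inl 0) (a 0) + pderiv (Sum.inl 0) (a 0)) =
      cub (X (Sum.inl (D + 1))) (X (Sum.inl D))
        * (pderiv (Sum.inl D) (a 1) + pderiv (Sum.inl 1) (a D)) →
    killVar (Sum.inl D) (a 1) = 0 → a 1 = C c * lead1 D := by
  intro D c a hD _hsupp h0 haD hstar hkill
  have key : cub (X (Sum.inl 0)) (X (Sum.inl 1))
        * shift (pderiv (Sum.inl 0) (a 0) + pderiv (Sum.inl 0) (a 0)) =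
      cub (X (Sum.inl (D + 1))) (X (Sum.inl D))
        * (pderiv (Sum.inl D) (C c * lead1 D) + pderiv (Sum.inl 1) (a D)) := by
    rw [h0, haD, pderiv_C_mul, pderiv_C_mul, pderiv_C_mul, pd0_lead0 (by omega), pdD_lead1 hD,
      pd1_leadD (by omega)]
    simp only [map_add, map_mul, shift_C, shift_gam, shift_prodsq_Ico, shift_cub, shift_X_inl,
      map_ofNat, zero_add, sub_add_cancel, Int.reduceAdd]
    rw [prodsq_split 2 (D - 1) D (by omega) (by omega), prodsq_single (D - 1) D (by ring)]
    ring
  refine eq_of_pderiv_of_killVar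
    (add_right_cancel (mul_left_cancel₀ (cub_inl_ne_zero (show D + 1 ≠ D by omega))
      (hstar.symm.trans key))) ?_
  rw [hkill, map_mul, lead1]
  simp only [map_mul, killVar_cub_self, zero_mul, mul_zero]

/-- **Step `y = 2` of the transport recursion** (`D ≥ 4`): if moreover `a_1 = c·lead1 D`, the
transport equation `(★)_2` holds and `a_2` vanishes on `q_D = 0`, then `a_2 = c·leadMid D 2`.
[folklore] -/
theorem core_step_two : ∀ {D : ℤ} (c : ℝ) (a : ℤ → R), 4 ≤ D →
    (∀ z, a z ∈ supported ℝ (Sum.inl '' Set.Icc (0 : ℤ) D)) → a 0 = C c * lead0 D →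
    a D = C c * leadD D → a 1 = C c * lead1 D →
    cub (X (Sum.inl 0)) (X (Sum.inl 1))
        * shift (pderiv (Sum.inl 0) (a 1) + pderiv (Sum.inl 1) (a 0)) =
      cub (X (Sum.inl (D + 1))) (X (Sum.inl D))
        * (pderiv (Sum.inl D) (a 2) + pderiv (Sum.inl 2) (a D)) →
    killVar (Sum.inl D) (a 2) = 0 → a 2 = C c * leadMid D 2 := by
  intro D c a hD _hsupp h0 haD h1 hstar hkill
  have key : cub (X (Sum.inl 0)) (X (Sum.inl 1))
        * shift (pderiv (Sum.inl 0) (a 1) + pderiv (Sum.inl 1) (a 0)) =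
      cub (X (Sum.inl (D + 1))) (X (Sum.inl D))
        * (pderiv (Sum.inl D) (C c * leadMid D 2) + pderiv (Sum.inl 2) (a D)) := by
    rw [h1, h0, haD, pderiv_C_mul, pderiv_C_mul, pderiv_C_mul, pderiv_C_mul,
      pd0_lead1 (by omega), pdk_lead0 (k := 1) (by norm_num) (by omega),
      pdD_leadMid (y := 2) (by norm_num) (by omega), pdk_leadD (k := 2) (by norm_num) (by omega)]
    simp only [map_add, map_mul, map_sub, shift_C, shift_gam, shift_prodsq_Ico, shift_cub,
      shift_X_inl, map_ofNat, zero_add, sub_add_cancel, Int.reduceAdd, Int.reduceSub, Int.reduceMul,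
      prodsq_empty', one_mul]
    rw [prodsq_split 3 (D - 1) D (by omega) (by omega), prodsq_single (D - 1) D (by ring)]
    push_cast
    simp only [map_ofNat]
    ring
  refine eq_of_pderiv_of_killVar
    (add_right_cancel (mul_left_cancel₀ (cub_inl_ne_zero (show D + 1 ≠ D by omega))
      (hstar.symm.trans key))) ?_
  rw [hkill, map_mul, leadMid]
  simp only [map_mul, killVar_cub_self, zero_mul, mul_zero]

/-- **Generic step of the transport recursion** (`3 ≤ y ≤ D-2`): if `a_0 = c·lead0 D`,
`a_D = c·leadD D`, `a_{y-1} = c·leadMid D (y-1)`, the transport equation `(★)_y` holds and `a_y`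
vanishes on `q_D = 0`, then `a_y = c·leadMid D y`. [folklore] -/
theorem core_step_generic : ∀ {D : ℤ} (c : ℝ) (a : ℤ → R) (y : ℤ), 3 ≤ y → y ≤ D - 2 →
    (∀ z, a z ∈ supported ℝ (Sum.inl '' Set.Icc (0 : ℤ) D)) →
    a 0 = C c * lead0 D → a D = C c * leadD D → a (y - 1) = C c * leadMid D (y - 1) →
    cub (X (Sum.inl 0)) (X (Sum.inl 1))
        * shift (pderiv (Sum.inl 0) (a (y - 1)) + pderiv (Sum.inl (y - 1)) (a 0)) =
      cub (X (Sum.inl (D + 1))) (X (Sum.inl D))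
        * (pderiv (Sum.inl D) (a y) + pderiv (Sum.inl y) (a D)) →
    killVar (Sum.inl D) (a y) = 0 → a y = C c * leadMid D y := by
  intro D c a y hy hyD _hsupp h0 haD hprev hstar hkill
  have key : cub (X (Sum.inl 0)) (X (Sum.inl 1))
        * shift (pderiv (Sum.inl 0) (a (y - 1)) + pderiv (Sum.inl (y - 1)) (a 0)) =
      cub (X (Sum.inl (D + 1))) (X (Sum.inl D))
        * (pderiv (Sum.inl D) (C c * leadMid D y) + pderiv (Sum.inl y) (a D)) := by
    rw [hprev, h0, haD, pderiv_C_mul, pderiv_C_mul, pderiv_C_mul, pderiv_C_mul,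
      pd0_leadMid (z := y - 1) (by omega) (by omega),
      pdk_lead0 (k := y - 1) (by omega) (by omega), pdD_leadMid (y := y) (by omega) hyD,
      pdk_leadD (k := y) (by omega) (by omega)]
    simp only [show y - 1 - 1 = y - 2 by ring, show y - 2 + 1 = y - 1 by ring, map_add, map_mul,
      map_sub, map_pow, shift_C, shift_gam, shift_prodsq_Ico, shift_cub, shift_X_inl, map_ofNat,
      zero_add, sub_add_cancel, Int.reduceAdd]
    rw [prodsq_split 1 2 (y - 1) (by norm_num) (by omega), prodsq_single 1 2 (by norm_num),
      prodsq_split (y + 1) (D - 1) D (by omega) (by omega), prodsq_single (D - 1) D (by ring)]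
    push_cast
    simp only [map_add, map_sub, map_mul, map_ofNat, map_one, map_intCast]
    ring
  refine eq_of_pderiv_of_killVar
    (add_right_cancel (mul_left_cancel₀ (cub_inl_ne_zero (show D + 1 ≠ D by omega))
      (hstar.symm.trans key))) ?_
  rw [hkill, map_mul, leadMid]
  simp only [map_mul, killVar_cub_self, zero_mul, mul_zero]

end Summit.AtomisticToContinuum.FouriersLaw.Theorems.OddChargeAlgebra

end
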